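import Mathlib
import Summits.Ventures.PercRepro2.Defs
import Summits.Ventures.PercRepro2.Harris
import Summits.Ventures.PercRepro2.CoinDefs
import Summits.Ventures.PercRepro2.CoinInduced
import Summits.Ventures.PercRepro2.CoinLsmCoreDefs
import Summits.Ventures.PercRepro2.CoinLsmCoreU
import Summits.Ventures.PercRepro2.CoinOrTailKDefs
import Summits.Ventures.PercRepro2.CoinTreeCore
import Summits.Ventures.PercRepro2.CoinKSureTailSums
import Summits.Ventures.PercRepro2.CoinSubdivide
import Summits.Ventures.PercRepro2.CoinKSureSubOrTail
import Summits.Ventures.PercRepro2.CoinKSureSubLsm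
import Summits.Ventures.PercRepro2.CoinKSureTailCoins
import Summits.Ventures.PercRepro2.CoinKSureMarkerBCoins
import Summits.Ventures.PercRepro2.CoinChainMarkerA

/-!
# The first marker at the OR-vertex `a'` with ARBITRARY `a'`-entry coins (blind cell PercRepro2,
night-2 g17; proofs/NIGHT2-DARC.md §57.8)

`darc_of_chainMarkerA'` needs sure entry coins on `a'`.  Subdividing those coins by sure arcs
(§52): `a'` becomes a sure-entered OR-vertex of the extended core (`orTailK_sub`), the OR-vertex
`a` above it survives untouched (`orTailK_sub_untouched'`), the extended core stays
log-supermodular (`subCore_lsm`, packaged in `OrTailK.sub_data`), and row 2′DARC is invariant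
under the subdivision (`darc_sub_iff`): `darc_of_chainMarkerA'_coins` — ANY coins on the
`a'`-entries, on the chain arc and on `a`'s other entry — with the mirror and the out-tree
corollary.
-/

namespace Summit.Ventures.PercRepro2.Coin

open Classical

section ChainMarkerACoins

variable {V : Type*} {E : Type*} [Fintype V] [DecidableEq V] [Fintype E] [DecidableEq E]
  {R : Type*} [Field R] [LinearOrder R] [IsStrictOrderedRing R]
  {arcs : E → Finset (V × V)} {s : V} {U : Finset V} {ent ent' : Finset V} {c c' : V → E}
  {a a' w : V}

/-- **THEOREM (the first marker at the OR-vertex `a'`, ARBITRARY coins everywhere).**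
`OrTailK arcs s U ent' c' a'` with ANY entry set and ANY coins, `OrTailK arcs s (insert a' U) ent c a`
with `ent ⊆ {a', m₂}` and ANY coins, `SameEnds`, the cluster law of `U` log-supermodular,
`m₂ ∈ U`, `t, w ∉ U ∪ {a, a', s}` ⟹ `DARC pr arcs s {t} a' m₂ a w`. -/
theorem darc_of_chainMarkerA'_coins (pr : E → R) (hp : IsProbVec pr) (hS : SameEnds arcs)
    (h' : OrTailK arcs s U ent' c' a') (h : OrTailK arcs s (insert a' U) ent c a)
    {m₂ : V} (hm₂ : m₂ ∈ U) (hcov : ∀ r ∈ ent, r = a' ∨ r = m₂)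
    (hν : ∀ W W', W ⊆ U → W' ⊆ U →
      prob pr (coreLevel arcs s U W) * prob pr (coreLevel arcs s U W') ≤
        prob pr (coreLevel arcs s U (W ∩ W')) * prob pr (coreLevel arcs s U (W ∪ W')))
    {t : V} (htC : t ∉ insert a (insert a' U)) (hts : t ≠ s) (hws : w ≠ s)
    (hwC : w ∉ insert a (insert a' U)) :
    DARC pr arcs s {t} a' m₂ a w := by
  have ha'U : a' ∉ U := h'.a_notin
  have haU' : a ∉ insert a' U := h.a_notin
  have ha'a : a' ≠ a := fun e => haU' (e ▸ Finset.mem_insert_self a' U)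
  -- the subdivided coins: the entry coins of `a'`
  have hSa' := h'.arcs_entry
  have hsrc : ∀ e ∈ ent'.image c', srcOf ent' c' s e ∈ insert a' U :=
    fun e he => Finset.mem_insert_of_mem (h'.ent_sub (h'.srcOf_mem he))
  have htgts : ∀ e ∈ ent'.image c', (fun _ => a') e ≠ s := fun _ _ => h'.a_ne_s
  have htgta : ∀ e ∈ ent'.image c', (fun _ => a') e ≠ a := fun _ _ => ha'a
  have hc₀ : ∀ r ∈ ent, c r ∉ ent'.image c' := by
    intro r hr hmem
    obtain ⟨q, hq, hqr⟩ := Finset.mem_image.1 hmem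
    have h1 := h.arcs_c r hr
    have h2 := h'.arcs_c q hq
    rw [hqr] at h2
    rw [h1] at h2
    have : (r, a) ∈ ({(q, a')} : Finset (V × V)) := by rw [← h2]; exact Finset.mem_singleton_self _
    rw [Finset.mem_singleton, Prod.mk.injEq] at this
    exact ha'a this.2.symm
  -- the two OR-vertices of the subdivided system
  have h_sub := orTailK_sub_untouched' (S := ent'.image c') (src := srcOf ent' c' s)
    (tgt := fun _ => a') h hsrc htgts htgta hc₀
  rw [subCore_insert_left] at h_sub
  have h'_sub := orTailK_sub h'
  have htC₁ : t ∉ insert a' U := fun hx => htC (Finset.mem_insert_of_mem hx)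
  have hwC₁ : w ∉ insert a' U := fun hx => hwC (Finset.mem_insert_of_mem hx)
  obtain ⟨hsure', hν', _, _⟩ := h'.sub_data (w := w) pr hp hν htC₁ hwC₁
  have hm₂' : Sum.inl m₂ ∈ subCore U (ent'.image c') := (inl_mem_subCore).2 hm₂
  have hcov' : ∀ r ∈ ent.map (Function.Embedding.inl : V ↪ V ⊕ E),
      r = (Sum.inl a' : V ⊕ E) ∨ r = (Sum.inl m₂ : V ⊕ E) := by
    intro r hr
    obtain ⟨r₀, hr₀, rfl⟩ := Finset.mem_map.1 hr
    rcases hcov r₀ hr₀ with rfl | rfl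
    · exact Or.inl rfl
    · exact Or.inr rfl
  have htC' : Sum.inl t ∉ insert (Sum.inl a) (insert (Sum.inl a') (subCore U (ent'.image c'))) := by
    rw [Finset.mem_insert, Finset.mem_insert, inl_mem_subCore, not_or, not_or]
    rw [Finset.mem_insert, Finset.mem_insert, not_or, not_or] at htC
    exact ⟨fun e => htC.1 (Sum.inl_injective e), fun e => htC.2.1 (Sum.inl_injective e), htC.2.2⟩
  have hwC' : Sum.inl w ∉ insert (Sum.inl a) (insert (Sum.inl a') (subCore U (ent'.image c'))) := by
    rw [Finset.mem_insert, Finset.mem_insert, inl_mem_subCore, not_or, not_or]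
    rw [Finset.mem_insert, Finset.mem_insert, not_or, not_or] at hwC
    exact ⟨fun e => hwC.1 (Sum.inl_injective e), fun e => hwC.2.1 (Sum.inl_injective e), hwC.2.2⟩
  have key := darc_of_chainMarkerA' (subPr pr) (isProbVec_subPr hp) (sameEnds_sub hS) h'_sub h_sub
    hsure' hm₂' hcov' hν' htC' (fun e => hts (Sum.inl_injective e))
    (fun e => hws (Sum.inl_injective e)) hwC'
  have hiff := darc_sub_iff hSa' pr s {t} a' m₂ a w
  rw [Finset.map_singleton] at hiff
  exact hiff.1 key

/-- **The mirror: markers `(m₂, a')`, arbitrary coins.** -/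
theorem darc_of_chainMarkerA'_coins_swap (pr : E → R) (hp : IsProbVec pr) (hS : SameEnds arcs)
    (h' : OrTailK arcs s U ent' c' a') (h : OrTailK arcs s (insert a' U) ent c a)
    {m₂ : V} (hm₂ : m₂ ∈ U) (hcov : ∀ r ∈ ent, r = a' ∨ r = m₂)
    (hν : ∀ W W', W ⊆ U → W' ⊆ U →
      prob pr (coreLevel arcs s U W) * prob pr (coreLevel arcs s U W') ≤
        prob pr (coreLevel arcs s U (W ∩ W')) * prob pr (coreLevel arcs s U (W ∪ W')))
    {t : V} (htC : t ∉ insert a (insert a' U)) (hts : t ≠ s) (hws : w ≠ s)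
    (hwC : w ∉ insert a (insert a' U)) :
    DARC pr arcs s {t} m₂ a' a w :=
  (darc_swap pr arcs s {t} a' m₂ a w).1
    (darc_of_chainMarkerA'_coins pr hp hS h' h hm₂ hcov hν htC hts hws hwC)

/-- **COROLLARY (out-tree core, arbitrary coins).** -/
theorem darc_of_chainTreeMarkerA'_coins (pr : E → R) (hp : IsProbVec pr) (hS : SameEnds arcs)
    (h' : OrTailK arcs s U ent' c' a') (h : OrTailK arcs s (insert a' U) ent c a)
    {cT : V → E} {par : V → V} {rk : V → ℕ} (hT : TreeCore arcs s U cT par rk)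
    {m₂ : V} (hm₂ : m₂ ∈ U) (hcov : ∀ r ∈ ent, r = a' ∨ r = m₂)
    {t : V} (htC : t ∉ insert a (insert a' U)) (hts : t ≠ s) (hws : w ≠ s)
    (hwC : w ∉ insert a (insert a' U)) :
    DARC pr arcs s {t} a' m₂ a w :=
  darc_of_chainMarkerA'_coins pr hp hS h' h hm₂ hcov (hT.coreLevel_lsm pr hp) htC hts hws hwC

end ChainMarkerACoins

end Summit.Ventures.PercRepro2.Coin
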